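import Summits.Ventures.CertifiedQuantumChemistry.Rows.CIUpperBound
import Literature.MathematicalPhysics.QuantumChemistry.SectorPoincareInequalities
import HarnessLib

/-!
# Rows/SecondEigenvalueUpperRows.lean: TWO-STATE Rayleigh–Ritz (Poincaré `λ₂ ≤ Λ₂`) sector row + exact-`ℚ` CI pair

HONEST FRAMING (verbatim): certified bounds for a stated model Hamiltonian in a stated basis; not a claim about
the real molecule or material beyond that model.

LADDER-CHEM I-TYPE (cell chem-oracle, seat chem-type-06 gen 4, offer (H) H2; chem-lead A7: ≤ 150 l., producer-agnostic,
no Temple/GapCertificate objects). Soundness is `Literature/…/SectorPoincareInequalities.lean` (Weinstein–Stenger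
(1972) Ch. 2 §1 Thm 1 (Poincaré) eq. (2) p. 10; HJO (2000) §4.2.4 (4.2.41) p. 116); here, over the venture's objects:
* `CIVec.crossNormSq`, `CIVec.crossEnergy : ℚ` — BILINEAR exact-`ℚ` bridge `⟨ψ.vec, φ.vec⟩`, `⟨ψ.vec, H_F φ.vec⟩`;
* `PairUpperCertificate F a b hi` (two independent sector vectors, Rayleigh quotient `≤ hi` on their span) and the
  ROW `SecondUpperRow F a b hi` (a sector GROUND state `ψ₀` and an orthogonal sector eigenstate `ψ₁`,
  `E₀(F; a, b) ≤ e₁ ≤ hi`); `secondUpperRow_of_pairCertificate` (soundness), `SecondUpperRow.upperRow`;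
* `PairUpperCertificate.formBound_le` — every form bound `σ‖z‖² ≤ Re⟨z, H_F z⟩` on the sector vectors orthogonal
  to one fixed vector has `σ ≤ hi` (the certified ceiling a pair certificate puts on such legs);
* `CIVec.pairUpperCertificate` — KERNEL ENTRY: two sector-pure records, Gram determinant `> 0`, `p, q ≥ 0`,
  `c² ≤ p q` in `ℚ` ⇒ `PairUpperCertificate`.
First consumer (A7): door-M1 STEP-1 gap fractions «(β* − U₀)/(hi₁ − L₀)» from two DMRG/CI sector states. NOT
here: any number, claim node, Temple or gap-certificate object. -/

namespace Summit.Ventures.CertifiedQuantumChemistry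

open Matrix Finset
open Literature.MathematicalPhysics.QuantumLattice Literature.MathematicalPhysics.QuantumChemistry
open scoped ComplexOrder

variable {k n m : ℕ}

namespace CIVec

/-- `⟨ψ, φ⟩` of two CI records as a rational (determinants need not be distinct or shared). -/
def crossNormSq (ψ : CIVec k n) (φ : CIVec k m) : ℚ :=
  ∑ i, ∑ j, if ψ.det i = φ.det j then ψ.coeff i * φ.coeff j else 0

/-- `⟨ψ, H_F φ⟩` of two CI records as a rational, through the Slater–Condon mirror `Model.slaterCondon`. -/
def crossEnergy (F : Model k) (ψ : CIVec k n) (φ : CIVec k m) : ℚ :=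
  ∑ i, ∑ j, ψ.coeff i * φ.coeff j * F.slaterCondon (ψ.det i) (φ.det j)

/-- Bilinear expansion `⟨ψ, X φ⟩ = Σ_ij c_i d_j X_{D_i D'_j}` (two records). -/
theorem star_vec_dotProduct_mulVec_vec (ψ : CIVec k n) (φ : CIVec k m)
    (X : Matrix (Finset (Orb (Fin k))) (Finset (Orb (Fin k))) ℂ) :
    star ψ.vec ⬝ᵥ X *ᵥ φ.vec =
      ∑ i, ∑ j, ((ψ.coeff i : ℚ) : ℂ) * ((φ.coeff j : ℚ) : ℂ) * X (ψ.det i) (φ.det j) := by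
  simp only [vec, star_sum, star_smul, Matrix.mulVec_sum, Matrix.mulVec_smul, sum_dotProduct,
    dotProduct_sum, smul_dotProduct, dotProduct_smul, smul_eq_mul, Model.star_single_dotProduct,
    mulVec_single_one, col_apply, Finset.mul_sum]
  rw [Finset.sum_comm]
  exact sum_congr rfl fun i _ => sum_congr rfl fun j _ => by rw [Complex.star_def, map_ratCast]; ring

/-- `⟨ψ, H_F φ⟩` is the rational `crossEnergy`. -/
theorem star_vec_dotProduct_hamiltonian_mulVec_vec (F : Model k) (ψ : CIVec k n) (φ : CIVec k m) :
    star ψ.vec ⬝ᵥ F.hamiltonian *ᵥ φ.vec = ((ψ.crossEnergy F φ : ℚ) : ℂ) := by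
  rw [star_vec_dotProduct_mulVec_vec, crossEnergy]; push_cast
  simp only [Model.hamiltonian_apply_eq_slaterCondon]

/-- `⟨ψ, φ⟩` is the rational `crossNormSq`. -/
theorem star_vec_dotProduct_vec_vec (ψ : CIVec k n) (φ : CIVec k m) :
    star ψ.vec ⬝ᵥ φ.vec = ((ψ.crossNormSq φ : ℚ) : ℂ) := by
  have h := star_vec_dotProduct_mulVec_vec ψ φ 1
  rw [one_mulVec] at h
  rw [h, crossNormSq]; push_cast
  exact sum_congr rfl fun i _ => sum_congr rfl fun j _ => by rw [Matrix.one_apply]; split_ifs <;> simp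

end CIVec

/-- **Two-state Rayleigh–Ritz certificate** (producer-agnostic): two linearly independent `(a, b)`-sector vectors
on whose span the Rayleigh quotient of `H_F` is `≤ hi` (`hi ≥ Λ₂` of the `2 × 2` secular equation, Weinstein–Stenger
(1972) Ch. 2 §3 p. 13); CI pairs: `CIVec.pairUpperCertificate`. [cite: WeinsteinStenger1972, Ch. 2 §3 eqs. (5)-(6), p. 13] -/
def PairUpperCertificate (F : Model k) (a b : ℕ) (hi : ℚ) : Prop :=
  ∃ x y : Fock (Orb (Fin k)), IsInSector a b x ∧ IsInSector a b y ∧ LinearIndependent ℂ ![x, y] ∧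
    ∀ α β : ℂ, (star (α • x + β • y) ⬝ᵥ F.hamiltonian *ᵥ (α • x + β • y)).re ≤
      ((hi : ℚ) : ℝ) * (star (α • x + β • y) ⬝ᵥ (α • x + β • y)).re

/-- **Second-eigenvalue upper row** `E₁(F; a, b) ≤ hi` ("`λ₂ ≤ Λ₂`", Weinstein–Stenger (1972) Ch. 2 §1 Thm 1 eq. (2),
p. 10) in eigenpair form: a sector GROUND state `ψ₀` (`H_F ψ₀ = E₀(F; a, b) ψ₀`) and an ORTHOGONAL unit sector
eigenstate `ψ₁`, `H_F ψ₁ = e₁ ψ₁`, with `E₀ ≤ e₁ ≤ hi`. [cite: WeinsteinStenger1972, Ch. 2 §1 Thm 1 eq. (2), p. 10] -/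
def SecondUpperRow (F : Model k) (a b : ℕ) (hi : ℚ) : Prop :=
  ∃ (ψ₀ ψ₁ : Fock (Orb (Fin k))) (e₁ : ℝ), IsInSector a b ψ₀ ∧ IsInSector a b ψ₁ ∧ star ψ₀ ⬝ᵥ ψ₀ = 1 ∧
    star ψ₁ ⬝ᵥ ψ₁ = 1 ∧ star ψ₀ ⬝ᵥ ψ₁ = 0 ∧ F.hamiltonian *ᵥ ψ₀ = ((F.energy a b : ℝ) : ℂ) • ψ₀ ∧
    F.hamiltonian *ᵥ ψ₁ = (e₁ : ℂ) • ψ₁ ∧ F.energy a b ≤ e₁ ∧ e₁ ≤ ((hi : ℚ) : ℝ)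

/-- **SOUNDNESS** (Poincaré `λ₂ ≤ Λ₂` in the sector): `PairUpperCertificate → SecondUpperRow` for a symmetric model.
[cite: WeinsteinStenger1972, Ch. 2 §1 Thm 1 eq. (2), p. 10] -/
theorem secondUpperRow_of_pairCertificate {F : Model k} (hF : F.IsSymmetric) {a b : ℕ} {hi : ℚ}
    (h : PairUpperCertificate F a b hi) : SecondUpperRow F a b hi := by
  obtain ⟨x, y, hx, hy, hxy, hu⟩ := h
  exact exists_two_orthonormal_sectorEigen_le_of_pair_of_commute (Model.hamiltonian_isHermitian hF)
    (molecularHamiltonian_commute_totalNumber _ _ _) (molecularHamiltonian_commute_spinZ _ _ _) hx hy hxy hu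

/-- The second-eigenvalue row implies the ordinary upper row `E₀(F; a, b) ≤ hi` (with its range). -/
theorem SecondUpperRow.upperRow {F : Model k} {a b : ℕ} {hi : ℚ} (h : SecondUpperRow F a b hi) :
    UpperRow F a b hi := by
  obtain ⟨ψ₀, -, e₁, hψ₀, -, h00, -, -, -, -, hle, hhi⟩ := h
  obtain ⟨ha, hb⟩ := range_of_isInSector_ne_zero hψ₀ (by rintro rfl; simp at h00)
  exact ⟨ha, hb, hle.trans hhi⟩

/-- **Ceiling on codimension-one form bounds**: a pair certificate at `hi` forces `σ ≤ hi` for every `σ` with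
`σ‖z‖² ≤ Re⟨z, H_F z⟩` on the sector vectors `z ⊥ v` (dimension count). [cite: HornJohnson2013, Thm 4.2.6, p. 235] -/
theorem PairUpperCertificate.formBound_le {F : Model k} {a b : ℕ} {hi : ℚ} (h : PairUpperCertificate F a b hi)
    (v : Fock (Orb (Fin k))) {σ : ℝ} (hσ : ∀ z : Fock (Orb (Fin k)), IsInSector a b z → star v ⬝ᵥ z = 0 →
      σ * (star z ⬝ᵥ z).re ≤ (star z ⬝ᵥ F.hamiltonian *ᵥ z).re) : σ ≤ ((hi : ℚ) : ℝ) := by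
  obtain ⟨x, y, hx, hy, hxy, hu⟩ := h
  exact le_of_codimOne_sector_form_bound_of_pair v hσ hx hy hxy hu

/-- **KERNEL ENTRY FOR CI PAIR CERTIFICATES.** Two sector-pure records of a symmetric model with Gram determinant
`normSq ψ · normSq φ − crossNormSq² > 0` and, for `p = hi·normSq ψ − energy ψ`, `q = hi·normSq φ − energy φ`,
`c = hi·crossNormSq − crossEnergy`: `0 ≤ p`, `0 ≤ q`, `c² ≤ p·q` (six decidable facts in `ℚ`) give
`PairUpperCertificate F a b hi`. [cite: WeinsteinStenger1972, Ch. 2 §3 eqs. (5)-(6), p. 13] -/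
theorem CIVec.pairUpperCertificate {F : Model k} (hF : F.IsSymmetric) (ψ : CIVec k n) (φ : CIVec k m)
    {a b : ℕ} {hi : ℚ} (hψ : ψ.InSector a b) (hφ : φ.InSector a b)
    (hgram : ψ.crossNormSq φ ^ 2 < ψ.normSq * φ.normSq) (hp : ψ.energy F ≤ hi * ψ.normSq)
    (hq : φ.energy F ≤ hi * φ.normSq) (hc : (hi * ψ.crossNormSq φ - ψ.crossEnergy F φ) ^ 2 ≤
      (hi * ψ.normSq - ψ.energy F) * (hi * φ.normSq - φ.energy F)) :
    PairUpperCertificate F a b hi := by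
  have hxx := ψ.star_vec_dotProduct_vec; have hyy := φ.star_vec_dotProduct_vec
  have hxy := ψ.star_vec_dotProduct_vec_vec φ
  have hyx : star φ.vec ⬝ᵥ ψ.vec = ((ψ.crossNormSq φ : ℚ) : ℂ) := by
    rw [star_dotProduct, hxy, Complex.star_def, map_ratCast]
  refine ⟨ψ.vec, φ.vec, CIVec.isInSector_vec hψ, CIVec.isInSector_vec hφ, ?_, fun α β => ?_⟩
  · refine LinearIndependent.pair_iff.2 fun s t hst => ?_
    have h1 : s * (ψ.normSq : ℂ) + t * (ψ.crossNormSq φ : ℂ) = 0 := by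
      have := congrArg (fun w => star ψ.vec ⬝ᵥ w) hst
      simpa [dotProduct_add, dotProduct_smul, hxx, hxy] using this
    have h2 : s * (ψ.crossNormSq φ : ℂ) + t * (φ.normSq : ℂ) = 0 := by
      have := congrArg (fun w => star φ.vec ⬝ᵥ w) hst
      simpa [dotProduct_add, dotProduct_smul, hyy, hyx] using this
    have hdet : ((ψ.normSq * φ.normSq - ψ.crossNormSq φ ^ 2 : ℚ) : ℂ) ≠ 0 := mod_cast (sub_pos.2 hgram).ne'
    have hs : s * ((ψ.normSq * φ.normSq - ψ.crossNormSq φ ^ 2 : ℚ) : ℂ) = 0 := by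
      push_cast; linear_combination (φ.normSq : ℂ) * h1 - (ψ.crossNormSq φ : ℂ) * h2
    have ht : t * ((ψ.normSq * φ.normSq - ψ.crossNormSq φ ^ 2 : ℚ) : ℂ) = 0 := by
      push_cast; linear_combination (ψ.normSq : ℂ) * h2 - (ψ.crossNormSq φ : ℂ) * h1
    exact ⟨(mul_eq_zero.1 hs).resolve_right hdet, (mul_eq_zero.1 ht).resolve_right hdet⟩
  · refine re_rayleigh_pair_le_of_psd (Model.hamiltonian_isHermitian hF) ψ.vec φ.vec ?_ ?_ ?_ α β
    · rw [ψ.star_vec_dotProduct_hamiltonian_mulVec, hxx, Complex.ratCast_re, Complex.ratCast_re]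
      exact_mod_cast hp
    · rw [φ.star_vec_dotProduct_hamiltonian_mulVec, hyy, Complex.ratCast_re, Complex.ratCast_re]
      exact_mod_cast hq
    · rw [ψ.star_vec_dotProduct_hamiltonian_mulVec_vec, hxy, ψ.star_vec_dotProduct_hamiltonian_mulVec, hxx,
        φ.star_vec_dotProduct_hamiltonian_mulVec, hyy]
      simp only [Complex.ratCast_re, Complex.ofReal_ratCast]
      have hcast : ((hi : ℚ) : ℂ) * ((ψ.crossNormSq φ : ℚ) : ℂ) - ((ψ.crossEnergy F φ : ℚ) : ℂ) =
          (((hi * ψ.crossNormSq φ - ψ.crossEnergy F φ : ℚ) : ℝ) : ℂ) := by push_cast; ring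
      rw [hcast, Complex.norm_real, Real.norm_eq_abs, sq_abs]
      exact_mod_cast hc

end Summit.Ventures.CertifiedQuantumChemistry
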